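import Mathlib
import Summits.Ventures.PercRepro2.Defs
import Summits.Ventures.PercRepro2.Graph
import Summits.Ventures.PercRepro2.HullDefs
import Summits.Ventures.PercRepro2.LocRows
import Summits.Ventures.PercRepro2.SwRow
import Summits.Ventures.PercRepro2.SwAllRow
import Summits.Ventures.PercRepro2.TypedRow

/-!
# The doubly typed rigid row, general form (blind cell PercRepro2, night-4 g7, 2026-08-25;
proofs/NIGHT4-G7.md §9)

The typed rigid row `LocRows.TypedSwAll` carries monotone conditions on the two clusters of the root
`l` (an up-set `𝓤` for `C_R(l)`, a down-set `𝓓` for `C_B(l)`).  The 2-cut composition asks for the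
same row with conditions AT THE AVOIDED VERTEX `h` as well: a set `X` of vertices that lie outside
the hull of `h`, and an up-set condition `𝓤′` on the blue cluster of `h`.  This is the GENERAL form: `gTypedQ` is the class
`{h ∉ H_l, C_R(l) ∈ 𝓤, C_B(l) ∈ 𝓓, C_R(h) ∈ 𝓓″, X ∩ H_h = ∅, C_B(h) ∈ 𝓤′}` (a down-set `𝓓″` for
the red cluster of `h`, a set `X` outside both clusters of `h`, an up-set `𝓤′` for the blue cluster
of `h`) and `GTypedSwAll` asks for a rigid permutation of it (every red edge inside `C_R(h)` flipped).
`TypedSwAll` is the case `𝓓″ = 𝓤′ = univ`, `X = ∅` (`typed_of_gTyped`).  Census (night-4 g7,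
dtyped.py / dtyped3.py): 0 failures on all connected graphs `n ≤ 5` for all `𝓤`, `𝓓` with ≤ 1
generator and each avoided-vertex condition separately — `x ∉ C_R(h)`: 0 / 7,440; `X` of size ≤ 2
outside the hull: 0 / 3,760; `a ∈ C_B(h)`: 0 / 6,744 — while `x ∉ C_B(h)` alone (2,206 / 4,552) and
`x ∈ C_R(h)` (2,632 / 2,632) are FALSE: the avoided-vertex conditions must be the ones a rigid flip
can respect (red cluster down, blue cluster up, hull avoidance).  The side-2 classes of the 2-cut
composition are instances: `(n,n,1,0)` is `GTypedSwAll u h ↑v (↑v)ᶜ univ {v} univ`, a status-`b`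
vertex `x` is `𝓓″ = (↑x)ᶜ`, `𝓤′ = ↑x`.
-/

namespace Summit.Ventures.PercRepro2

namespace LocRows

open Hull

variable {V : Type*} {E : Type*} [Fintype E] [DecidableEq E]

open scoped Classical

variable (ends : E → Sym2 V)

/-- The general doubly typed class
`{h ∉ H_l, C_R(l) ∈ 𝓤, C_B(l) ∈ 𝓓, C_R(h) ∈ 𝓓″, X ∩ H_h = ∅, C_B(h) ∈ 𝓤′}`. -/
noncomputable def gTypedQ (l h : V) (𝓤 𝓓 𝓓'' : Set (Set V)) (X : Set V) (𝓤' : Set (Set V)) :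
    Finset (Config E) :=
  Finset.univ.filter fun ζ =>
    h ∉ hull ends ζ l ∧ cluster ends ζ l ∈ 𝓤 ∧ cluster ends (blue ζ) l ∈ 𝓓 ∧
      cluster ends ζ h ∈ 𝓓'' ∧ (∀ x ∈ X, x ∉ hull ends ζ h) ∧ cluster ends (blue ζ) h ∈ 𝓤'

/-- **The general doubly typed rigid row**: a rigid permutation of `gTypedQ`. -/
def GTypedSwAll (l h : V) (𝓤 𝓓 𝓓'' : Set (Set V)) (X : Set V) (𝓤' : Set (Set V)) : Prop :=
  ∃ f : {ζ // ζ ∈ gTypedQ ends l h 𝓤 𝓓 𝓓'' X 𝓤'} → Config E, Function.Injective f ∧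
    ∀ x, f x ∈ gTypedQ ends l h 𝓤 𝓓 𝓓'' X 𝓤' ∧
      ∀ e, e ∈ within ends (cluster ends x.1 h) → x.1 e = true → f x e = false

/-- Without avoided-vertex conditions the general doubly typed class is the typed class. -/
lemma gTypedQ_trivial (l h : V) (𝓤 𝓓 : Set (Set V)) :
    gTypedQ ends l h 𝓤 𝓓 Set.univ ∅ Set.univ = typedQ ends l h 𝓤 𝓓 := by
  ext ζ
  simp [gTypedQ, typedQ]

/-- **The general doubly typed row without avoided-vertex conditions is the typed row.** -/
theorem typed_of_gTyped {l h : V} {𝓤 𝓓 : Set (Set V)}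
    (hD : GTypedSwAll ends l h 𝓤 𝓓 Set.univ ∅ Set.univ) : TypedSwAll ends l h 𝓤 𝓓 := by
  obtain ⟨f, hf, hmem⟩ := hD
  have e := gTypedQ_trivial ends l h 𝓤 𝓓
  have hin : ∀ x : {ζ // ζ ∈ typedQ ends l h 𝓤 𝓓},
      x.1 ∈ gTypedQ ends l h 𝓤 𝓓 Set.univ ∅ Set.univ := fun x => by rw [e]; exact x.2
  have hiff : ∀ ζ, ζ ∈ gTypedQ ends l h 𝓤 𝓓 Set.univ ∅ Set.univ ↔ ζ ∈ typedQ ends l h 𝓤 𝓓 :=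
    fun ζ => by rw [e]
  refine ⟨fun x => f ⟨x.1, hin x⟩, ?_, fun x => ?_⟩
  · intro x y hxy
    have h1 : (⟨x.1, hin x⟩ : {ζ // ζ ∈ gTypedQ ends l h 𝓤 𝓓 Set.univ ∅ Set.univ}) =
        ⟨y.1, hin y⟩ := hf hxy
    exact Subtype.ext (Subtype.mk.inj h1)
  · obtain ⟨h1, h2⟩ := hmem ⟨x.1, hin x⟩
    exact ⟨(hiff _).1 h1, h2⟩

/-- The general doubly typed row over all finite graphs, markings and families (`𝓤`, `𝓤′`
up-sets, `𝓓`, `𝓓″` down-sets, `X` any vertex set). -/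
def GTypedSwAll_all : Prop :=
  ∀ (V E : Type) [Fintype V] [DecidableEq V] [Fintype E] [DecidableEq E] (ends : E → Sym2 V)
    (l h : V) (𝓤 𝓓 𝓓'' : Set (Set V)) (X : Set V) (𝓤' : Set (Set V)), IsUpperSet 𝓤 →
      IsLowerSet 𝓓 → IsLowerSet 𝓓'' → IsUpperSet 𝓤' → GTypedSwAll ends l h 𝓤 𝓓 𝓓'' X 𝓤'

/-- `GTypedSwAll_all` gives `TypedSwAll_all`. -/
theorem typed_all_of_gTyped_all (hD : GTypedSwAll_all) : TypedSwAll_all := by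
  intro V E _ _ _ _ ends l h 𝓤 𝓓 h𝓤 h𝓓
  exact typed_of_gTyped ends
    (hD V E ends l h 𝓤 𝓓 Set.univ ∅ Set.univ h𝓤 h𝓓 isLowerSet_univ isUpperSet_univ)

/-- `GTypedSwAll_all` gives `SwAll_all`, hence `Sw_all`. -/
theorem swAll_all_of_gTyped_all (hD : GTypedSwAll_all) : SwAll_all :=
  swAll_all_of_typed_all (typed_all_of_gTyped_all hD)

/-- `GTypedSwAll_all` gives `Sw_all`. -/
theorem sw_all_of_gTyped_all (hD : GTypedSwAll_all) : Sw_all :=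
  sw_all_of_typed_all (typed_all_of_gTyped_all hD)

end LocRows

end Summit.Ventures.PercRepro2
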